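import Summits.QuantumFields.YangMills.Theorems.FluctuationComparisonRegPrIntLS2BetaQuaternionReadOneStepBracket
import Summits.QuantumFields.YangMills.Theorems.FluctuationComparisonRegPrIntLS2BetaQuaternionReadDerivLocalSup
import HarnessLib

/-!
# S2β · AVG₂♭-ax_q, THE SUP CHAIN (UV3-NODE §94; px16 g22 LANE RULING 16:37:04Z), FILE 1 of 2 — THE PROPAGATED ONE-STEP BRACKET: for `t < K − J`,
# `Σ_B ‖(T_t br_t)(B)‖ ≤ C_P·C_br·ℓ²·L^t·Σ_B ‖log η⁽ᴶ⁺ᵗ⁺¹⁾|_{READ_t(B)}‖²_∞` — Q9b's one-step bracket bound (BR) at the descended pair, truncated to Q10's read set, propagated by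
# Q10's local-sup (D2) (the k-uniform SUP propagation ✓p825421 at the organ); the summand of the SUP TOWER BUDGET (ST) appears on the right

Cell `ym3-torus` (YM ladder rung R3 = continuum `SU(2)` Yang–Mills on the three-torus at fixed lattice data — a RUNG: NOT d = 4, NOT infinite volume, NOT a mass gap,
NOT Clay).  Width seat «width 17» `ym3-torus-px17` (gen 22); crux `stmt-QuantumFields-20520` (`…Theses.UnitScaleTilt.FluctuationComparisonRegPrIntL`), LINE g18-1 S2β,
organ GAP♯∘ ⟸ {h3, (D-stage)×2, LOC} by kernel.  `--kind proof --supports stmt-QuantumFields-20520 --as helper`, count-neutral, DEFINITION-FREE (0 `def`, 0 `instance`,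
0 `notation`, 0 `sorry`).  Notation of the docstrings: `K = J + k`, `W` a second field on `(F.P K)`, `η⁽ᵘ⁾` the chord field of the descended pair `(D_{u,K}W, D_{u,K}U₀)`,
`T_t := DMq_{J←J+t}(D_{J+t,K}U₀)`, `br_t := η⁽ᴶ⁺ᵗ⁾ − S_t η⁽ᴶ⁺ᵗ⁺¹⁾` (`S_t` = the one-step linearisation at base `D_{J+t+1,K}U₀`), `C_br = 4551000`, `ℓ = (d+2)L = 5L`,
`C_P = (1 + 4(d+2))·exp(c₃·Σ_{i<K−J}(5L)²∕4·θ(K−i))`, `c₃ = (d+2)(422 + 1616(d+2))`; `READ_t(B) := {ℓ′ : ∃ b : PBond (F.P (J+t)) 0, ⟨Q10's truncation condition of b w.r.t. B at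
(J, J+t)⟩ ∧ ⟨Q9b's two-block condition of ℓ′ w.r.t. b⟩}` — everything spelled inline («max over the read set» in def-free clothes = the Pi-sup norm of the truncated field).

WHAT IS PROVED (sorry-free).
§1 bookkeeping: `theta_partial_sum_succ`, `theta_partial_sum_mono` (a sub-tower's history sum is bounded by the full tower's), `pi_norm_le_of_pointwise`.
§2 ★★`bracket_apply_le` — for `t < K − J`, every bond `b` of level `J+t`: `‖br_t b‖ ≤ C_br·ℓ²·‖log η⁽ᴶ⁺ᵗ⁺¹⁾|_{blocks(b)}‖²_∞` (Q9b ✓`norm_oneStepBracket_le` at the descended pair,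
   lit ✓`descendTo_descendTo`; base `D_{J+t+1,K}U₀ ∈ histGood θ (J+t+1) (J+t)` by Q7 §1).
§3 ★★`truncate_bracket_le` — the Q10-truncation of `br_t` w.r.t. `B` has sup `≤ C_br·ℓ²·‖log η⁽ᴶ⁺ᵗ⁺¹⁾|_{READ_t(B)}‖²_∞`; ★★★`term_le` —
   `Σ_B ‖(T_t br_t)(B)‖ ≤ C_P·(C_br·ℓ²)·(L^t·Σ_B ‖log η⁽ᴶ⁺ᵗ⁺¹⁾|_{READ_t(B)}‖²_∞)` (Q10 ✓`sum_norm_qfderiv_apply_le_local` at `(J, J+t)`).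
FILE 2 (`…S2BetaLocalOfSupTower`) sums §3 over `t` against Q7's telescope: LOC (✓p828403's `hLoc`) ⟸ the SUP TOWER BUDGET (ST).

INHABITATION (★★OWNER RULING №100): LAW-FREE — bounds on bracket and chord fields of a pair of configurations along the (0.4) tower; no fibre law, no score, no integrability.

HONEST SCOPE.  Bookkeeping (finite sums, Pi-sup norms) over Q7 ✓p827759, Q9b, Q10 by name; nothing of Bałaban's analysis is asserted or proved ([Balaban1985Averaging] Prop. 3 (123) p.36,
Prop. 4 (134)–(135) p.38, (139)–(147) pp.39–40 are the printed SUP statements this chain transcribes); (ST), LOC, TAYLOR♭_q, AVG₂♭-ax_q, (D-ax), h3 HYPOTHESES; GAP♯∘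
(`stub_uniformFibreGapOrbit`, registry 3732b7df UNTOUCHED), S2β, the five registered stubs (0∕5), 20520, 19936, 19200, `YM3TorusSU2` are NOT proved; rung R3 — NOT d = 4, NOT infinite
volume, NOT a mass gap, NOT Clay; the Yang–Mills mass gap is NOT proved.
-/

set_option autoImplicit false

noncomputable section

open scoped Matrix.Norms.L2Operator Topology RealInnerProductSpace Quaternion
open Set Function
open Literature.MathematicalPhysics.QuantumLattice (su2Quat)
open Literature.MathematicalPhysics.QuantumFieldTheory.Balaban1983to89
open Literature.MathematicalPhysics.QuantumFieldTheory.Balaban1983to89.T3ContinuumYM3Torus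
open Literature.MathematicalPhysics.QuantumFieldTheory.Balaban1983to89.T3UnitLawDensityEML (ℰp)
open Literature.MathematicalPhysics.QuantumFieldTheory.Balaban1983to89.T3UnitScaleTilt
open Literature.MathematicalPhysics.QuantumFieldTheory.Balaban1983to89.T3TiltDescent
open Literature.MathematicalPhysics.QuantumFieldTheory.Balaban1983to89.T3DescentFibreTower
open Literature.MathematicalPhysics.QuantumFieldTheory.Balaban1983to89.T3LevelShift
open Literature.MathematicalPhysics.QuantumFieldTheory.Balaban1983to89.ExpMeanLog (deltaSU)
open Literature.MathematicalPhysics.QuantumFieldTheory.Balaban1983to89.T4HaarSU2ExpChart (expPoint)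
open Literature.MathematicalPhysics.QuantumFieldTheory.Balaban1983to89.T4ExpWindowSmallField (imVec logVec)
open Literature.MathematicalPhysics.QuantumFieldTheory.Balaban1983to89.T4Continuum
open Summit.QuantumFields.YangMills.Theorems.FluctuationComparisonRegPrIntLS2BetaQuaternionReadFibreIdentity (imVec_su2Quat_expPoint)
open Summit.QuantumFields.YangMills.Theorems.FluctuationComparisonRegPrIntLS2BetaQuaternionReadTowerTelescope
  (chord_sub_fderiv_qRead_chord_eq_sum histGood_of_le descendTo_mem_histGood)
open Summit.QuantumFields.YangMills.Theorems.FluctuationComparisonRegPrIntLS2BetaQuaternionReadOneStepBracket (norm_oneStepBracket_le)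
open Summit.QuantumFields.YangMills.Theorems.FluctuationComparisonRegPrIntLS2BetaQuaternionReadDerivLocalSup (sum_norm_qfderiv_apply_le_local)

namespace Summit.QuantumFields.YangMills.Theorems.FluctuationComparisonRegPrIntLS2BetaSupTowerTerm

variable {F : T3Family}

/-! ## §1 Bookkeeping: sub-tower history sums; Pi-sup norms -/

section Bookkeeping

/-- One more level in the history sum: `Σ_{i<t+1} w·θ(J+(t+1)−i) = w·θ(J+t+1) + Σ_{i<t} w·θ(J+t−i)`. [cite: Balaban1985UV3, (7) p.257 (bookkeeping)] -/
theorem theta_partial_sum_succ (θ : ℕ → ℝ) (w : ℝ) (J t : ℕ) :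
    ∑ i ∈ Finset.range (t + 1), w * θ (J + (t + 1) - i) = w * θ (J + t + 1) + ∑ i ∈ Finset.range t, w * θ (J + t - i) := by
  rw [Finset.sum_range_succ', add_comm]
  congr 1
  refine Finset.sum_congr rfl fun i hi => ?_
  rw [Finset.mem_range] at hi
  congr 2
  omega

/-- **A SUB-TOWER's HISTORY SUM IS BOUNDED BY THE FULL TOWER's**: for `t ≤ k`, `θ ≥ 0`, `w ≥ 0`: `Σ_{i<t} w·θ(J+t−i) ≤ Σ_{i<k} w·θ(J+k−i)`.
[cite: Balaban1985UV3, (7) p.257 (bookkeeping)] -/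
theorem theta_partial_sum_mono (θ : ℕ → ℝ) (hθ0 : ∀ i, 0 ≤ θ i) {w : ℝ} (hw : 0 ≤ w) (J : ℕ) {t k : ℕ} (htk : t ≤ k) :
    ∑ i ∈ Finset.range t, w * θ (J + t - i) ≤ ∑ i ∈ Finset.range k, w * θ (J + k - i) := by
  induction k with
  | zero =>
    have ht : t = 0 := Nat.le_zero.mp htk
    subst ht; exact le_rfl
  | succ k ih =>
    rcases Nat.lt_or_ge t (k + 1) with hlt | hge
    · have h1 := ih (Nat.le_of_lt_succ hlt)
      rw [theta_partial_sum_succ]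
      have h2 : 0 ≤ w * θ (J + k + 1) := mul_nonneg hw (hθ0 _)
      linarith
    · have ht : t = k + 1 := le_antisymm htk hge
      subst ht; exact le_rfl

/-- Pi-sup norms: a pointwise comparison of two finite families gives the comparison of their sup norms. [folklore] -/
theorem pi_norm_le_of_pointwise {ι : Type*} [Fintype ι] {E E' : Type*} [SeminormedAddCommGroup E] [SeminormedAddCommGroup E'] (f : ι → E) (g : ι → E')
    (h : ∀ i, ‖f i‖ ≤ ‖g i‖) : ‖f‖ ≤ ‖g‖ :=
  (pi_norm_le_iff_of_nonneg (norm_nonneg _)).2 fun i => (h i).trans (norm_le_pi_norm g i)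

end Bookkeeping

/-! ## §2 The one-step bracket of the descended pair, bond by bond (Q9b at the tower) -/

section Bracket

/-- ★★ **THE ONE-STEP BRACKET AT LEVEL `J+t`, BOND BY BOND**: for `t < K − J`, `U₀ ∈ histGood θ K J` under Q1's guards, and any `W`, at every bond `b` of level `J+t`:
`‖η⁽ᴶ⁺ᵗ⁾ b − (S_t η⁽ᴶ⁺ᵗ⁺¹⁾) b‖ ≤ 4551000·((d+2)L)²·‖log η⁽ᴶ⁺ᵗ⁺¹⁾|_{blocks(b)}‖²_∞` ((BR) = Q9b ✓`norm_oneStepBracket_le` at the descended pair `(D_{J+t+1,K}W, D_{J+t+1,K}U₀)`;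
`D_{J+t,K} = D_{J+t,J+t+1} ∘ D_{J+t+1,K}` lit ✓`descendTo_descendTo`). [cite: Balaban1985Averaging, Prop. 3 (123) p.36; Balaban1987RG1, (0.4), (0.11) p.253; Balaban1985UV3, (7) p.257] -/
theorem bracket_apply_le {J K : ℕ} (hJK : J ≤ K) {t : ℕ} (ht : t < K - J) {θ : ℕ → ℝ} (hθ0 : ∀ i, 0 ≤ θ i) {α : ℝ}
    (hθα : ∀ i, J < i → i ≤ K → (((5 * F.L : ℕ) : ℝ) ^ 2 / 4) * θ i ≤ α)
    (hα24 : α ≤ 1 / 24) (hαδ : α < deltaSU (Fin 2)) (hαL : 157 * α < ((F.L : ℝ) ^ 2)⁻¹)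
    {U₀ : GaugeField (F.P K) 0 (Matrix.specialUnitaryGroup (Fin 2) ℂ)} (hUg : U₀ ∈ histGood F ℰp θ K J) (W : GaugeField (F.P K) 0 (Matrix.specialUnitaryGroup (Fin 2) ℂ)) (b : PBond (F.P (J + t)) 0) :
    ‖((fun b : PBond (F.P (J + t)) 0 => imVec (su2Quat (descendTo F ℰp (J + t) K (by omega) W b * (descendTo F ℰp (J + t) K (by omega) U₀ b)⁻¹))) -
        (fderiv ℝ (fun (w : PBond (F.P (J + (t + 1))) 0 → EuclideanSpace ℝ (Fin 3)) (b : PBond (F.P (J + t)) 0) =>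
            imVec (su2Quat (descendTo F ℰp (J + t) (J + (t + 1)) (Nat.add_le_add_left (Nat.le_succ t) J)
              (fun ℓ => expPoint (w ℓ) * descendTo F ℰp (J + (t + 1)) K (by omega) U₀ ℓ) b *
              (descendTo F ℰp (J + t) (J + (t + 1)) (Nat.add_le_add_left (Nat.le_succ t) J) (descendTo F ℰp (J + (t + 1)) K (by omega) U₀) b)⁻¹))) 0)
          (fun ℓ => imVec (su2Quat (descendTo F ℰp (J + (t + 1)) K (by omega) W ℓ * (descendTo F ℰp (J + (t + 1)) K (by omega) U₀ ℓ)⁻¹)))) b‖ ≤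
      4551000 * ((((F.P (J + t + 1)).d + 2) * (F.P (J + t + 1)).L : ℕ) : ℝ) ^ 2 *
        ‖(fun ℓ' : PBond (F.P (J + t + 1)) 0 =>
            if blockOf ℓ'.src = (bondShift (F.sitesPerDir_eq (m := F.m) (K := J + t) (j := 0) (m' := F.m) (K' := J + t + 1) (j' := 1) (by omega)) b).src ∨
               blockOf ℓ'.src = (bondShift (F.sitesPerDir_eq (m := F.m) (K := J + t) (j := 0) (m' := F.m) (K' := J + t + 1) (j' := 1) (by omega)) b).tgt
            then logVec (su2Quat (descendTo F ℰp (J + (t + 1)) K (by omega) W ℓ' * (descendTo F ℰp (J + (t + 1)) K (by omega) U₀ ℓ')⁻¹)) else 0)‖ ^ 2 := by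
  -- the descended pair one level up and its one-step history
  have hK1 : J + (t + 1) ≤ K := by omega
  have hVg : descendTo F ℰp (J + (t + 1)) K hK1 U₀ ∈ histGood F ℰp θ (J + t + 1) (J + t) :=
    histGood_of_le (F := F) (Nat.le_add_right J t) (descendTo_mem_histGood (F := F) hK1 hUg)
  have hθα' : ∀ i', J + t < i' → i' ≤ J + t + 1 → (((5 * F.L : ℕ) : ℝ) ^ 2 / 4) * θ i' ≤ α :=
    fun i' h1 h2 => hθα i' (by omega) (by omega)
  have hj : 0 + 1 ≤ (F.P (J + t + 1)).m + (F.P (J + t + 1)).K := by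
    show 0 + 1 ≤ F.m + (J + t + 1); omega
  -- the tower law puts the level-`(J+t)` chord in Q9b's one-step form
  have e1 : descendTo F ℰp (J + t) K (by omega) W =
      descendTo F ℰp (J + t) (J + (t + 1)) (Nat.add_le_add_left (Nat.le_succ t) J) (descendTo F ℰp (J + (t + 1)) K hK1 W) :=
    (descendTo_descendTo F ℰp _ hK1 W).symm
  have e2 : descendTo F ℰp (J + t) K (by omega) U₀ =
      descendTo F ℰp (J + t) (J + (t + 1)) (Nat.add_le_add_left (Nat.le_succ t) J) (descendTo F ℰp (J + (t + 1)) K hK1 U₀) :=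
    (descendTo_descendTo F ℰp _ hK1 U₀).symm
  rw [Pi.sub_apply]
  beta_reduce
  rw [e1, e2]
  exact norm_oneStepBracket_le (F := F) (J + t) hj hθ0 hθα' hα24 hαδ hαL hVg (descendTo F ℰp (J + (t + 1)) K hK1 W) b

end Bracket

/-! ## §3 The truncated bracket and the propagated term -/

section Term

/-- ★★ **THE Q10-TRUNCATED BRACKET IS BOUNDED BY THE TRUNCATED LOG-CHORD SUP OF THE NEXT LEVEL**: for `t < K − J` and a coarsest bond `B`, the bracket field `br_t` truncated
to Q10's read set of `B` (at `(J, J+t)`) has Pi-sup norm `≤ 4551000·(5L)²·‖log η⁽ᴶ⁺ᵗ⁺¹⁾|_{READ_t(B)}‖²_∞`, `READ_t(B)` = the union over the read set of the two-block sets of Q9b.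
[cite: Balaban1985Averaging, Prop. 3 (123) p.36, (15) p.19; Balaban1987RG1, (0.4), (0.11) p.253] -/
theorem truncate_bracket_le {J K : ℕ} (hJK : J ≤ K) {t : ℕ} (ht : t < K - J) {θ : ℕ → ℝ} (hθ0 : ∀ i, 0 ≤ θ i) {α : ℝ}
    (hθα : ∀ i, J < i → i ≤ K → (((5 * F.L : ℕ) : ℝ) ^ 2 / 4) * θ i ≤ α)
    (hα24 : α ≤ 1 / 24) (hαδ : α < deltaSU (Fin 2)) (hαL : 157 * α < ((F.L : ℝ) ^ 2)⁻¹)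
    {U₀ : GaugeField (F.P K) 0 (Matrix.specialUnitaryGroup (Fin 2) ℂ)} (hUg : U₀ ∈ histGood F ℰp θ K J) (W : GaugeField (F.P K) 0 (Matrix.specialUnitaryGroup (Fin 2) ℂ)) (B : PBond (F.P J) 0) :
    ‖(fun b : PBond (F.P (J + t)) 0 =>
        if (B14.Eq22Determines.blockIter (J + t - J) b.src = (bondShift (F.sitesPerDir_eq (m := F.m) (K := J) (j := 0) (m' := F.m) (K' := J + t) (j' := J + t - J) (by omega)) B).src ∨ B14.Eq22Determines.blockIter (J + t - J) b.src = (bondShift (F.sitesPerDir_eq (m := F.m) (K := J) (j := 0) (m' := F.m) (K' := J + t) (j' := J + t - J) (by omega)) B).tgt) ∧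
                (B14.Eq22Determines.blockIter (J + t - J) b.tgt = (bondShift (F.sitesPerDir_eq (m := F.m) (K := J) (j := 0) (m' := F.m) (K' := J + t) (j' := J + t - J) (by omega)) B).src ∨ B14.Eq22Determines.blockIter (J + t - J) b.tgt = (bondShift (F.sitesPerDir_eq (m := F.m) (K := J) (j := 0) (m' := F.m) (K' := J + t) (j' := J + t - J) (by omega)) B).tgt)
        then ((fun b : PBond (F.P (J + t)) 0 => imVec (su2Quat (descendTo F ℰp (J + t) K (by omega) W b * (descendTo F ℰp (J + t) K (by omega) U₀ b)⁻¹))) -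
        (fderiv ℝ (fun (w : PBond (F.P (J + (t + 1))) 0 → EuclideanSpace ℝ (Fin 3)) (b : PBond (F.P (J + t)) 0) =>
            imVec (su2Quat (descendTo F ℰp (J + t) (J + (t + 1)) (Nat.add_le_add_left (Nat.le_succ t) J)
              (fun ℓ => expPoint (w ℓ) * descendTo F ℰp (J + (t + 1)) K (by omega) U₀ ℓ) b *
              (descendTo F ℰp (J + t) (J + (t + 1)) (Nat.add_le_add_left (Nat.le_succ t) J) (descendTo F ℰp (J + (t + 1)) K (by omega) U₀) b)⁻¹))) 0)
          (fun ℓ => imVec (su2Quat (descendTo F ℰp (J + (t + 1)) K (by omega) W ℓ * (descendTo F ℰp (J + (t + 1)) K (by omega) U₀ ℓ)⁻¹)))) b else 0)‖ ≤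
      (4551000 * ((5 * F.L : ℕ) : ℝ) ^ 2) *
        ‖(fun ℓ' : PBond (F.P (J + (t + 1))) 0 =>
              if ∃ b : PBond (F.P (J + t)) 0,
                ((B14.Eq22Determines.blockIter (J + t - J) b.src = (bondShift (F.sitesPerDir_eq (m := F.m) (K := J) (j := 0) (m' := F.m) (K' := J + t) (j' := J + t - J) (by omega)) B).src ∨ B14.Eq22Determines.blockIter (J + t - J) b.src = (bondShift (F.sitesPerDir_eq (m := F.m) (K := J) (j := 0) (m' := F.m) (K' := J + t) (j' := J + t - J) (by omega)) B).tgt) ∧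
                (B14.Eq22Determines.blockIter (J + t - J) b.tgt = (bondShift (F.sitesPerDir_eq (m := F.m) (K := J) (j := 0) (m' := F.m) (K' := J + t) (j' := J + t - J) (by omega)) B).src ∨ B14.Eq22Determines.blockIter (J + t - J) b.tgt = (bondShift (F.sitesPerDir_eq (m := F.m) (K := J) (j := 0) (m' := F.m) (K' := J + t) (j' := J + t - J) (by omega)) B).tgt)) ∧
                (blockOf ℓ'.src = (bondShift (F.sitesPerDir_eq (m := F.m) (K := J + t) (j := 0) (m' := F.m) (K' := J + t + 1) (j' := 1) (by omega)) b).src ∨ blockOf ℓ'.src = (bondShift (F.sitesPerDir_eq (m := F.m) (K := J + t) (j := 0) (m' := F.m) (K' := J + t + 1) (j' := 1) (by omega)) b).tgt)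
              then logVec (su2Quat (descendTo F ℰp (J + (t + 1)) K (by omega) W ℓ' * (descendTo F ℰp (J + (t + 1)) K (by omega) U₀ ℓ')⁻¹)) else 0)‖ ^ 2 := by
  have hC : (0 : ℝ) ≤ (4551000 * ((5 * F.L : ℕ) : ℝ) ^ 2) := by positivity
  refine (pi_norm_le_iff_of_nonneg (by positivity)).2 fun b => ?_
  by_cases hb : (B14.Eq22Determines.blockIter (J + t - J) b.src = (bondShift (F.sitesPerDir_eq (m := F.m) (K := J) (j := 0) (m' := F.m) (K' := J + t) (j' := J + t - J) (by omega)) B).src ∨ B14.Eq22Determines.blockIter (J + t - J) b.src = (bondShift (F.sitesPerDir_eq (m := F.m) (K := J) (j := 0) (m' := F.m) (K' := J + t) (j' := J + t - J) (by omega)) B).tgt) ∧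
                (B14.Eq22Determines.blockIter (J + t - J) b.tgt = (bondShift (F.sitesPerDir_eq (m := F.m) (K := J) (j := 0) (m' := F.m) (K' := J + t) (j' := J + t - J) (by omega)) B).src ∨ B14.Eq22Determines.blockIter (J + t - J) b.tgt = (bondShift (F.sitesPerDir_eq (m := F.m) (K := J) (j := 0) (m' := F.m) (K' := J + t) (j' := J + t - J) (by omega)) B).tgt)
  · rw [if_pos hb]
    have h1 := bracket_apply_le (F := F) hJK ht hθ0 hθα hα24 hαδ hαL hUg W b
    have hd : (F.P (J + t + 1)).d = 3 := rfl
    have hLL : (F.P (J + t + 1)).L = F.L := rfl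
    rw [hd, hLL] at h1
    refine h1.trans (mul_le_mul_of_nonneg_left ?_ hC)
    refine pow_le_pow_left₀ (norm_nonneg _) ?_ 2
    refine pi_norm_le_of_pointwise _ _ fun ℓ' => ?_
    by_cases h9 : (blockOf ℓ'.src = (bondShift (F.sitesPerDir_eq (m := F.m) (K := J + t) (j := 0) (m' := F.m) (K' := J + t + 1) (j' := 1) (by omega)) b).src ∨ blockOf ℓ'.src = (bondShift (F.sitesPerDir_eq (m := F.m) (K := J + t) (j := 0) (m' := F.m) (K' := J + t + 1) (j' := 1) (by omega)) b).tgt)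
    · have hex : ∃ b : PBond (F.P (J + t)) 0,
          ((B14.Eq22Determines.blockIter (J + t - J) b.src = (bondShift (F.sitesPerDir_eq (m := F.m) (K := J) (j := 0) (m' := F.m) (K' := J + t) (j' := J + t - J) (by omega)) B).src ∨ B14.Eq22Determines.blockIter (J + t - J) b.src = (bondShift (F.sitesPerDir_eq (m := F.m) (K := J) (j := 0) (m' := F.m) (K' := J + t) (j' := J + t - J) (by omega)) B).tgt) ∧
                (B14.Eq22Determines.blockIter (J + t - J) b.tgt = (bondShift (F.sitesPerDir_eq (m := F.m) (K := J) (j := 0) (m' := F.m) (K' := J + t) (j' := J + t - J) (by omega)) B).src ∨ B14.Eq22Determines.blockIter (J + t - J) b.tgt = (bondShift (F.sitesPerDir_eq (m := F.m) (K := J) (j := 0) (m' := F.m) (K' := J + t) (j' := J + t - J) (by omega)) B).tgt)) ∧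
          (blockOf ℓ'.src = (bondShift (F.sitesPerDir_eq (m := F.m) (K := J + t) (j := 0) (m' := F.m) (K' := J + t + 1) (j' := 1) (by omega)) b).src ∨ blockOf ℓ'.src = (bondShift (F.sitesPerDir_eq (m := F.m) (K := J + t) (j := 0) (m' := F.m) (K' := J + t + 1) (j' := 1) (by omega)) b).tgt) := ⟨b, hb, h9⟩
      simp only [h9, hex, if_true, le_refl]
    · simp only [h9, if_false, norm_zero, norm_nonneg]
  · rw [if_neg hb, norm_zero]; positivity

/-- ★★ **THE PROPAGATED TERM**: for `t < K − J`, `Σ_B ‖(T_t br_t)(B)‖ ≤ C_P·(4551000·(5L)²)·L^t·Σ_B ‖log η⁽ᴶ⁺ᵗ⁺¹⁾|_{READ_t(B)}‖²_∞`, `T_t = DMq_{J←J+t}(D_{J+t,K}U₀)`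
((D2-loc) = Q10 ✓`sum_norm_qfderiv_apply_le_local` at `(J, J+t)`, base `D_{J+t,K}U₀ ∈ histGood` by Q7 §1; the sub-tower's history sum ≤ the full tower's).
[cite: Balaban1985Averaging, (139)-(147) pp.39-40, Prop. 3 (123) p.36; Balaban1987RG1, (0.11) p.253; Balaban1985UV3, (7) p.257] -/
theorem term_le {J K : ℕ} (hJK : J ≤ K) {t : ℕ} (ht : t < K - J) {θ : ℕ → ℝ} (hθ0 : ∀ i, 0 ≤ θ i) {α : ℝ}
    (hθα : ∀ i, J < i → i ≤ K → (((5 * F.L : ℕ) : ℝ) ^ 2 / 4) * θ i ≤ α)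
    (hα24 : α ≤ 1 / 24) (hαδ : α < deltaSU (Fin 2)) (hαL : 157 * α < ((F.L : ℝ) ^ 2)⁻¹)
    {U₀ : GaugeField (F.P K) 0 (Matrix.specialUnitaryGroup (Fin 2) ℂ)} (hUg : U₀ ∈ histGood F ℰp θ K J) (W : GaugeField (F.P K) 0 (Matrix.specialUnitaryGroup (Fin 2) ℂ)) :
    ∑ B : PBond (F.P J) 0, ‖(fderiv ℝ (fun (y : PBond (F.P (J + t)) 0 → EuclideanSpace ℝ (Fin 3)) (B : PBond (F.P J) 0) =>
        imVec (su2Quat (descendTo F ℰp J (J + t) (Nat.le_add_right J t)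
          (fun b => expPoint (y b) * descendTo F ℰp (J + t) K (by omega) U₀ b) B *
          (descendTo F ℰp J (J + t) (Nat.le_add_right J t) (descendTo F ℰp (J + t) K (by omega) U₀) B)⁻¹))) 0)
        ((fun b : PBond (F.P (J + t)) 0 => imVec (su2Quat (descendTo F ℰp (J + t) K (by omega) W b * (descendTo F ℰp (J + t) K (by omega) U₀ b)⁻¹))) -
        (fderiv ℝ (fun (w : PBond (F.P (J + (t + 1))) 0 → EuclideanSpace ℝ (Fin 3)) (b : PBond (F.P (J + t)) 0) =>
            imVec (su2Quat (descendTo F ℰp (J + t) (J + (t + 1)) (Nat.add_le_add_left (Nat.le_succ t) J)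
              (fun ℓ => expPoint (w ℓ) * descendTo F ℰp (J + (t + 1)) K (by omega) U₀ ℓ) b *
              (descendTo F ℰp (J + t) (J + (t + 1)) (Nat.add_le_add_left (Nat.le_succ t) J) (descendTo F ℰp (J + (t + 1)) K (by omega) U₀) b)⁻¹))) 0)
          (fun ℓ => imVec (su2Quat (descendTo F ℰp (J + (t + 1)) K (by omega) W ℓ * (descendTo F ℰp (J + (t + 1)) K (by omega) U₀ ℓ)⁻¹)))) B‖ ≤
      ((1 + 4 * ((3 + 2 : ℕ) : ℝ)) * Real.exp (((3 + 2 : ℕ) : ℝ) * (422 + 1616 * ((3 + 2 : ℕ) : ℝ)) * ∑ i ∈ Finset.range (K - J), (((5 * F.L : ℕ) : ℝ) ^ 2 / 4) * θ (K - i))) * (4551000 * ((5 * F.L : ℕ) : ℝ) ^ 2) *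
        ((F.L : ℝ) ^ t * ∑ B : PBond (F.P J) 0,
          ‖(fun ℓ' : PBond (F.P (J + (t + 1))) 0 =>
              if ∃ b : PBond (F.P (J + t)) 0,
                ((B14.Eq22Determines.blockIter (J + t - J) b.src = (bondShift (F.sitesPerDir_eq (m := F.m) (K := J) (j := 0) (m' := F.m) (K' := J + t) (j' := J + t - J) (by omega)) B).src ∨ B14.Eq22Determines.blockIter (J + t - J) b.src = (bondShift (F.sitesPerDir_eq (m := F.m) (K := J) (j := 0) (m' := F.m) (K' := J + t) (j' := J + t - J) (by omega)) B).tgt) ∧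
                (B14.Eq22Determines.blockIter (J + t - J) b.tgt = (bondShift (F.sitesPerDir_eq (m := F.m) (K := J) (j := 0) (m' := F.m) (K' := J + t) (j' := J + t - J) (by omega)) B).src ∨ B14.Eq22Determines.blockIter (J + t - J) b.tgt = (bondShift (F.sitesPerDir_eq (m := F.m) (K := J) (j := 0) (m' := F.m) (K' := J + t) (j' := J + t - J) (by omega)) B).tgt)) ∧
                (blockOf ℓ'.src = (bondShift (F.sitesPerDir_eq (m := F.m) (K := J + t) (j := 0) (m' := F.m) (K' := J + t + 1) (j' := 1) (by omega)) b).src ∨ blockOf ℓ'.src = (bondShift (F.sitesPerDir_eq (m := F.m) (K := J + t) (j := 0) (m' := F.m) (K' := J + t + 1) (j' := 1) (by omega)) b).tgt)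
              then logVec (su2Quat (descendTo F ℰp (J + (t + 1)) K (by omega) W ℓ' * (descendTo F ℰp (J + (t + 1)) K (by omega) U₀ ℓ')⁻¹)) else 0)‖ ^ 2) := by
  -- Q10 at `(J, J+t)`, base `V_t := D_{J+t,K}U₀`
  have hVt : descendTo F ℰp (J + t) K (by omega) U₀ ∈ histGood F ℰp θ (J + t) J := descendTo_mem_histGood (F := F) _ hUg
  have hθα_t : ∀ i, J < i → i ≤ J + t → (((5 * F.L : ℕ) : ℝ) ^ 2 / 4) * θ i ≤ α := fun i h1 h2 => hθα i h1 (by omega)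
  have hQ10 := sum_norm_qfderiv_apply_le_local (F := F) (Nat.le_add_right J t) hθ0 hθα_t hα24 hαδ hαL hVt
    ((fun b : PBond (F.P (J + t)) 0 => imVec (su2Quat (descendTo F ℰp (J + t) K (by omega) W b * (descendTo F ℰp (J + t) K (by omega) U₀ b)⁻¹))) -
        (fderiv ℝ (fun (w : PBond (F.P (J + (t + 1))) 0 → EuclideanSpace ℝ (Fin 3)) (b : PBond (F.P (J + t)) 0) =>
            imVec (su2Quat (descendTo F ℰp (J + t) (J + (t + 1)) (Nat.add_le_add_left (Nat.le_succ t) J)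
              (fun ℓ => expPoint (w ℓ) * descendTo F ℰp (J + (t + 1)) K (by omega) U₀ ℓ) b *
              (descendTo F ℰp (J + t) (J + (t + 1)) (Nat.add_le_add_left (Nat.le_succ t) J) (descendTo F ℰp (J + (t + 1)) K (by omega) U₀) b)⁻¹))) 0)
          (fun ℓ => imVec (su2Quat (descendTo F ℰp (J + (t + 1)) K (by omega) W ℓ * (descendTo F ℰp (J + (t + 1)) K (by omega) U₀ ℓ)⁻¹))))
  have hd : (F.P (J + t)).d = 3 := rfl
  have hLL : (F.P (J + t)).L = F.L := rfl
  have hkt : J + t - J = t := Nat.add_sub_cancel_left J t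
  rw [hd, hLL] at hQ10
  refine hQ10.trans ?_
  -- the sub-tower's history sum is bounded by the full tower's; the truncations by §3a
  have hw : (0 : ℝ) ≤ ((5 * F.L : ℕ) : ℝ) ^ 2 / 4 := by positivity
  have hc3 : (0 : ℝ) ≤ ((3 + 2 : ℕ) : ℝ) * (422 + 1616 * ((3 + 2 : ℕ) : ℝ)) := by positivity
  have hsum : ∑ i ∈ Finset.range (J + t - J), (((5 * F.L : ℕ) : ℝ) ^ 2 / 4) * θ (J + t - i) ≤ ∑ i ∈ Finset.range (K - J), (((5 * F.L : ℕ) : ℝ) ^ 2 / 4) * θ (K - i) := by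
    rw [hkt]
    have hmono := theta_partial_sum_mono θ hθ0 hw J (show t ≤ K - J from ht.le)
    have hre : ∑ i ∈ Finset.range (K - J), (((5 * F.L : ℕ) : ℝ) ^ 2 / 4) * θ (J + (K - J) - i) = ∑ i ∈ Finset.range (K - J), (((5 * F.L : ℕ) : ℝ) ^ 2 / 4) * θ (K - i) := by
      refine Finset.sum_congr rfl fun i hi => ?_
      rw [Finset.mem_range] at hi
      congr 2; omega
    rw [hre] at hmono
    exact hmono
  have hexp : Real.exp (((3 + 2 : ℕ) : ℝ) * (422 + 1616 * ((3 + 2 : ℕ) : ℝ)) * ∑ i ∈ Finset.range (J + t - J), (((5 * F.L : ℕ) : ℝ) ^ 2 / 4) * θ (J + t - i)) ≤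
      Real.exp (((3 + 2 : ℕ) : ℝ) * (422 + 1616 * ((3 + 2 : ℕ) : ℝ)) * ∑ i ∈ Finset.range (K - J), (((5 * F.L : ℕ) : ℝ) ^ 2 / 4) * θ (K - i)) :=
    Real.exp_le_exp.2 (mul_le_mul_of_nonneg_left hsum hc3)
  have htr : ∑ B : PBond (F.P J) 0, ‖(fun b : PBond (F.P (J + t)) 0 =>
        if (B14.Eq22Determines.blockIter (J + t - J) b.src = (bondShift (F.sitesPerDir_eq (m := F.m) (K := J) (j := 0) (m' := F.m) (K' := J + t) (j' := J + t - J) (by omega)) B).src ∨ B14.Eq22Determines.blockIter (J + t - J) b.src = (bondShift (F.sitesPerDir_eq (m := F.m) (K := J) (j := 0) (m' := F.m) (K' := J + t) (j' := J + t - J) (by omega)) B).tgt) ∧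
                (B14.Eq22Determines.blockIter (J + t - J) b.tgt = (bondShift (F.sitesPerDir_eq (m := F.m) (K := J) (j := 0) (m' := F.m) (K' := J + t) (j' := J + t - J) (by omega)) B).src ∨ B14.Eq22Determines.blockIter (J + t - J) b.tgt = (bondShift (F.sitesPerDir_eq (m := F.m) (K := J) (j := 0) (m' := F.m) (K' := J + t) (j' := J + t - J) (by omega)) B).tgt)
        then ((fun b : PBond (F.P (J + t)) 0 => imVec (su2Quat (descendTo F ℰp (J + t) K (by omega) W b * (descendTo F ℰp (J + t) K (by omega) U₀ b)⁻¹))) -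
        (fderiv ℝ (fun (w : PBond (F.P (J + (t + 1))) 0 → EuclideanSpace ℝ (Fin 3)) (b : PBond (F.P (J + t)) 0) =>
            imVec (su2Quat (descendTo F ℰp (J + t) (J + (t + 1)) (Nat.add_le_add_left (Nat.le_succ t) J)
              (fun ℓ => expPoint (w ℓ) * descendTo F ℰp (J + (t + 1)) K (by omega) U₀ ℓ) b *
              (descendTo F ℰp (J + t) (J + (t + 1)) (Nat.add_le_add_left (Nat.le_succ t) J) (descendTo F ℰp (J + (t + 1)) K (by omega) U₀) b)⁻¹))) 0)
          (fun ℓ => imVec (su2Quat (descendTo F ℰp (J + (t + 1)) K (by omega) W ℓ * (descendTo F ℰp (J + (t + 1)) K (by omega) U₀ ℓ)⁻¹)))) b else 0)‖ ≤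
      ∑ B : PBond (F.P J) 0, (4551000 * ((5 * F.L : ℕ) : ℝ) ^ 2) *
        ‖(fun ℓ' : PBond (F.P (J + (t + 1))) 0 =>
              if ∃ b : PBond (F.P (J + t)) 0,
                ((B14.Eq22Determines.blockIter (J + t - J) b.src = (bondShift (F.sitesPerDir_eq (m := F.m) (K := J) (j := 0) (m' := F.m) (K' := J + t) (j' := J + t - J) (by omega)) B).src ∨ B14.Eq22Determines.blockIter (J + t - J) b.src = (bondShift (F.sitesPerDir_eq (m := F.m) (K := J) (j := 0) (m' := F.m) (K' := J + t) (j' := J + t - J) (by omega)) B).tgt) ∧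
                (B14.Eq22Determines.blockIter (J + t - J) b.tgt = (bondShift (F.sitesPerDir_eq (m := F.m) (K := J) (j := 0) (m' := F.m) (K' := J + t) (j' := J + t - J) (by omega)) B).src ∨ B14.Eq22Determines.blockIter (J + t - J) b.tgt = (bondShift (F.sitesPerDir_eq (m := F.m) (K := J) (j := 0) (m' := F.m) (K' := J + t) (j' := J + t - J) (by omega)) B).tgt)) ∧
                (blockOf ℓ'.src = (bondShift (F.sitesPerDir_eq (m := F.m) (K := J + t) (j := 0) (m' := F.m) (K' := J + t + 1) (j' := 1) (by omega)) b).src ∨ blockOf ℓ'.src = (bondShift (F.sitesPerDir_eq (m := F.m) (K := J + t) (j := 0) (m' := F.m) (K' := J + t + 1) (j' := 1) (by omega)) b).tgt)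
              then logVec (su2Quat (descendTo F ℰp (J + (t + 1)) K (by omega) W ℓ' * (descendTo F ℰp (J + (t + 1)) K (by omega) U₀ ℓ')⁻¹)) else 0)‖ ^ 2 :=
    Finset.sum_le_sum fun B _ => truncate_bracket_le (F := F) hJK ht hθ0 hθα hα24 hαδ hαL hUg W B
  rw [← Finset.mul_sum] at htr
  have hpow : (F.L : ℝ) ^ (J + t - J) = (F.L : ℝ) ^ t := by rw [hkt]
  have hA0 : (0 : ℝ) ≤ (1 + 4 * ((3 + 2 : ℕ) : ℝ)) := by positivity
  have hE0 : (0 : ℝ) ≤ Real.exp (((3 + 2 : ℕ) : ℝ) * (422 + 1616 * ((3 + 2 : ℕ) : ℝ)) *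
      ∑ i ∈ Finset.range (J + t - J), (((5 * F.L : ℕ) : ℝ) ^ 2 / 4) * θ (J + t - i)) := (Real.exp_pos _).le
  have hL0 : (0 : ℝ) ≤ (F.L : ℝ) ^ (J + t - J) := by positivity
  -- step 1: the truncations
  have s1 := mul_le_mul_of_nonneg_left htr (mul_nonneg (mul_nonneg hA0 hE0) hL0)
  refine s1.trans ?_
  -- step 2: the history envelope and the exponent
  rw [hpow]
  have hS0 : (0 : ℝ) ≤ ∑ B : PBond (F.P J) 0,
        ‖(fun ℓ' : PBond (F.P (J + (t + 1))) 0 =>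
              if ∃ b : PBond (F.P (J + t)) 0,
                ((B14.Eq22Determines.blockIter (J + t - J) b.src = (bondShift (F.sitesPerDir_eq (m := F.m) (K := J) (j := 0) (m' := F.m) (K' := J + t) (j' := J + t - J) (by omega)) B).src ∨ B14.Eq22Determines.blockIter (J + t - J) b.src = (bondShift (F.sitesPerDir_eq (m := F.m) (K := J) (j := 0) (m' := F.m) (K' := J + t) (j' := J + t - J) (by omega)) B).tgt) ∧
                (B14.Eq22Determines.blockIter (J + t - J) b.tgt = (bondShift (F.sitesPerDir_eq (m := F.m) (K := J) (j := 0) (m' := F.m) (K' := J + t) (j' := J + t - J) (by omega)) B).src ∨ B14.Eq22Determines.blockIter (J + t - J) b.tgt = (bondShift (F.sitesPerDir_eq (m := F.m) (K := J) (j := 0) (m' := F.m) (K' := J + t) (j' := J + t - J) (by omega)) B).tgt)) ∧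
                (blockOf ℓ'.src = (bondShift (F.sitesPerDir_eq (m := F.m) (K := J + t) (j := 0) (m' := F.m) (K' := J + t + 1) (j' := 1) (by omega)) b).src ∨ blockOf ℓ'.src = (bondShift (F.sitesPerDir_eq (m := F.m) (K := J + t) (j := 0) (m' := F.m) (K' := J + t + 1) (j' := 1) (by omega)) b).tgt)
              then logVec (su2Quat (descendTo F ℰp (J + (t + 1)) K (by omega) W ℓ' * (descendTo F ℰp (J + (t + 1)) K (by omega) U₀ ℓ')⁻¹)) else 0)‖ ^ 2 := Finset.sum_nonneg fun B _ => by positivity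
  have hC0 : (0 : ℝ) ≤ (4551000 * ((5 * F.L : ℕ) : ℝ) ^ 2) := by positivity
  have s2 : (1 + 4 * ((3 + 2 : ℕ) : ℝ)) *
        Real.exp (((3 + 2 : ℕ) : ℝ) * (422 + 1616 * ((3 + 2 : ℕ) : ℝ)) * ∑ i ∈ Finset.range (J + t - J), (((5 * F.L : ℕ) : ℝ) ^ 2 / 4) * θ (J + t - i)) ≤
      (1 + 4 * ((3 + 2 : ℕ) : ℝ)) * Real.exp (((3 + 2 : ℕ) : ℝ) * (422 + 1616 * ((3 + 2 : ℕ) : ℝ)) * ∑ i ∈ Finset.range (K - J), (((5 * F.L : ℕ) : ℝ) ^ 2 / 4) * θ (K - i)) :=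
    mul_le_mul_of_nonneg_left hexp hA0
  have hL0' : (0 : ℝ) ≤ (F.L : ℝ) ^ t := by positivity
  have s3 := mul_le_mul_of_nonneg_right (mul_le_mul_of_nonneg_right s2 hL0') (mul_nonneg hC0 hS0)
  refine s3.trans (le_of_eq ?_)
  ring

end Term

end Summit.QuantumFields.YangMills.Theorems.FluctuationComparisonRegPrIntLS2BetaSupTowerTerm

end
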